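import Mathlib
import HarnessLib
import Summits.NavierStokesRegularity.NavierStokesRegularity.Theses.LocalRuledPressureDoor
import Summits.NavierStokesRegularity.NavierStokesRegularity.Theorems.LocalPressureProfileDoorMonotonePressureProfileRigidity

/-!
# Route `LocalRuledPressureDoor` — crux `PressurelessProfileRigidity` (item stmt-NavierStokesRegularity-27998), BY NAME

Route `LocalRuledPressureDoor` (ns-idea-6 g6 LINE g6-1 «ruled pressure»; critic idea-crit-4 g5 PASS; tribunal №56
PASSED·FRONTIER), crux K2 `PressurelessProfileRigidity`: a door-class profile `v` on `(−∞,0) × ℝ³` (Type I in time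
`‖v(t,y)‖ ≤ C/√(−t)`, space–time decay `‖v(t,y)‖ ≤ D/(‖y‖+√(−t))`, continuous on the open slab, unit-viscosity
Oseen–Duhamel identity, divergence-free slices) whose Riesz pressure `Q[v(t)] = pressurePotential (v t)` vanishes
identically on every slice is NOT backward-singular at the apex `(0,0)`.

PROOF (tribunal T1 №56 r1 reading, seat ns-trib-t1-1 g10, certified `t1-r1-LRPDT1.lean` sha16 9714aea2ceaffced,
`h3_now`): the statement is the special case `Q ≡ 0` of the PROVED crux `MonotonePressureProfileRigidity` of the sibling
door `LocalPressureProfileDoor` (item 20180, `monotonePressureProfileRigidity_proof`: scale-monotone similarity pressure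
⇒ regular apex, via Tsai 1998 §5 / Pineau–Vicol Thm 1.9) — with `Q[v(t)] ≡ 0` for every `t < 0` both sides of the
scale-monotonicity hypothesis `(−e^{−σ}t)·Q[v(e^{−σ}t)](√(−e^{−σ}t)·y) ≤ (−t)·Q[v(t)](√(−t)·y)` are `0`.  The planner's
drift–heat maximum-principle engine (skeleton `PressurelessProfileRigidity_birth.lean` ccbb7824996af523, stubs
`stub_supTransport` / `stub_extinction`) is therefore not needed for the item; it stays a valid alternative line.

Prover ns-tc-p1 g5 (hand keyed by DIRECTOR-NS #240 (1)); corollary credited to tribunal T1 (ns-trib-t1-1 g10).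
WHAT THIS IS NOT: a lemma about HYPOTHETICAL Type-I blow-up profiles (the door class); the door's lever
`RuledPressureCollapse` (27999) and its `Target` (27997) are separate items; NO statement about Navier–Stokes regularity
is proved or claimed.
-/

-- the summit and its single problem share the name (D-0017 nested layout)
set_option linter.dupNamespace false

namespace Summit.NavierStokesRegularity.NavierStokesRegularity.Theorems

/-- **Crux `PressurelessProfileRigidity` (item 27998) BY NAME**: a pressureless door-class profile is not
backward-singular at the apex — the case `Q ≡ 0` of the proved `MonotonePressureProfileRigidity` (item 20180):
the scale-monotonicity hypothesis reads `0 ≤ 0`. -/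
theorem localRuledPressureDoor_pressurelessProfileRigidity_proof :
    Theses.LocalRuledPressureDoor.PressurelessProfileRigidity := by
  intro C D v hrate hdecay hcont hmild hdiv hQ
  refine LocalPressureProfileDoorMonotonePressureProfileRigidity.monotonePressureProfileRigidity_proof C D v hrate
    hdecay hcont hmild hdiv ?_
  intro t ht σ _ y
  have ht' : Real.exp (-σ) * t < 0 := mul_neg_of_pos_of_neg (Real.exp_pos _) ht
  simp only [hQ t ht, hQ _ ht', mul_zero, le_refl]

end Summit.NavierStokesRegularity.NavierStokesRegularity.Theorems
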